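import Mathlib
import HarnessLib
import HarnessLib.Audit
import Summits.AtomisticToContinuum.Statement
import Literature.MathematicalPhysics.QuantumManyBody.PeriodicBoseGas

/-!
Route: BECDeletionTolerance

CLOSED (retired) 2026-08-15T13:38:42Z by operator:999:1257524 — reason: not-a-thesis: assembly does not conclude the sub-problem Statement — note: D-0027 §2.1 audit (human 2026-08-15: routes that do not decide the summit are removed): the assembly concludes `Literature.MathematicalPhysics.QuantumManyBody.BoseGas.BoseEinsteinCondensation`, not the sub-problem statement; a NEW conforming route may be opened from the same idea (generated `closes . The file is kept as the record of this route; refuted decls are indexed as negative knowledge (`ledger negatives`).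

# Route BECDeletionTolerance — BEC from chi-square deletion tolerance of the positive ground state
(n0 >= N / E[L^3 p(x1|rest)]), with the bosonized Fermi sea as benchmark

It suffices to show CHI-SQUARE DELETION TOLERANCE of the Dirichlet ground state (X =
ChiSquareTolerance): for every
repulsive finite-range v, at every small density rho, there is C = C(v, rho) such that for all large
N and EVERY slack
delta > 0 some delta-near-minimiser Psi of the N-body Dirichlet energy in the box of side L =
(N/rho)^{1/3} has mean
self-conditional density m2(Psi) := L^3 * Int_Y Int_x |Psi(x,Y)|^4 / (Int_x' |Psi(x',Y)|^2) <= C,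
i.e. E_mu[L^3 p(x1 | x2..xN)]
<= C for the Born law mu = |Psi|^2 (m2 = 1 + chi^2(law of (x1,rest) || uniform x marginal):
quantitative insertion/deletion
tolerance of the ground-state point process). The spine card chi2-deletion-tolerance-fermi-benchmark
is realised in a
SHARPENED form: for Psi >= 0 the constant-mode occupation obeys the exact bound n0(Psi) >= N /
m2(Psi) (two Hoelder steps,
support item DeletionBound), so X lands on the Dirichlet constant-mode criterion X_B1
(stmt-AtomisticToContinuum-0686) whose
implication to the conjunct is already PROVED (BECInfraredBound.Assembly_holds); the transfer from
the positive ground state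
to complex C^1 near-minimisers is the crux DeletionReachesGroundState; the card's benchmark (F) is
the crux FermiSeaBenchmark.
Lean: `∀ v : ℝ → ENNReal,
Literature.MathematicalPhysics.QuantumManyBody.BoseGas.IsRepulsiveFiniteRange v → ∃ ρ₀ : ℝ, 0 < ρ₀ ∧
∀ ρ : ℝ, 0 < ρ → ρ < ρ₀ → ∃ C : ℝ, 0 < C ∧ ∀ᶠ n : ℕ in Filter.atTop, ∀ δ : ENNReal, 0 < δ → ∃ Ψ :
Literature.MathematicalPhysics.QuantumManyBody.BoseGas.TrialState (n + 1)
(Literature.MathematicalPhysics.QuantumManyBody.BoseGas.sideLength ρ (n + 1)),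
Literature.MathematicalPhysics.QuantumManyBody.BoseGas.energy v Ψ ≤
Literature.MathematicalPhysics.QuantumManyBody.BoseGas.groundStateEnergy v (n + 1)
(Literature.MathematicalPhysics.QuantumManyBody.BoseGas.sideLength ρ (n + 1)) + δ ∧ ENNReal.ofReal
(Literature.MathematicalPhysics.QuantumManyBody.BoseGas.sideLength ρ (n + 1) ^ 3) * (∫⁻ Y :
Literature.MathematicalPhysics.QuantumManyBody.BoseGas.Config n, ∫⁻ x :
Literature.MathematicalPhysics.QuantumManyBody.BoseGas.Space, (‖Ψ.ψ (Matrix.vecCons x Y)‖₊ :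
ENNReal) ^ 4 / (∫⁻ x' : Literature.MathematicalPhysics.QuantumManyBody.BoseGas.Space, (‖Ψ.ψ
(Matrix.vecCons x' Y)‖₊ : ENNReal) ^ 2)) ≤ ENNReal.ofReal C`

## Assembly
Pure logic plus two library lemmas (checked in Sketch.lean, rc 0): given v, take rho0 and C(rho)
from ChiSquareTolerance and
rho0' from DeletionReachesGroundState; for rho < min(rho0, rho0') intersect the two eventualities in
n; feed the
ChiSquareTolerance witnesses (one per delta) into DeletionReachesGroundState at the same C to get
delta > 0 with
<phi0, gamma_Psi phi0> >= (n+1)/(2C) for every delta-near-minimiser; this is X_B1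
(stmt-AtomisticToContinuum-0686) with
c = 1/(2C) after the index shift N = n+1, and X_B1 -> BoseEinsteinCondensation is the proved theorem
AtomisticToContinuum.BECInfraredBound.bec_of_zeroMode (occupation_le_maxOccupation,
le_condensateNumber).

Rationale: WHY THIS LINE. Mechanism (checked by hand, two lines): for Psi >= 0 write b(Y) = Int_x Psi^2, S(Y) =
Int_x Psi, A(Y) = Int_x Psi^4; Hoelder gives
b <= S^{2/3} A^{1/3}, hence b <= S (A/b)^{1/2}, and Cauchy-Schwarz in Y gives 1 = (Int_Y b)^2 <=
(Int_Y S^2)(Int_Y A/b) =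
(n0 L^3/N)(m2/L^3), i.e. n0 >= N/m2 — no translation invariance, no spectral theory, valid in the
Dirichlet box; it is sharp for
the free torus gas (m2 = 1) and, on the Jastrow/LHY picture of the dilute ground state
(ReattoChester1967, Reatto1969,
LiebSeiringerSolovejYngvason2005 Ch. 2-3), m2 = <e^{-2W}>/<e^{-W}>^2 ~ 1 + O(sqrt(rho a^3)) because
the insertion landscape
W(x) = sum_j u(x - y_j), u ~ 2a/r for a < r < xi, has variance 16 pi rho a^2 xi = O(sqrt(rho a^3))
in d = 3 — the Bogoliubov
depletion ORDER comes out of a one-line inequality. What is imported: point-process theory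
(insertion/deletion tolerance
HolroydSoo2013 Thm 1.1-1.2, Palm measures of determinantal processes ShiraiTakahashi2003, rigidity /
Palm singularity
GhoshPeres2017, Bufetov2018, hyperuniformity GhoshLebowitz2017) as the language in which 'BEC iff a
deleted boson cannot be
located in mean square' becomes a theorem schema, and random-matrix / DPP calculus
(HughesKeatingOconnell2001,
TorquatoScardicchioZachary2008 §4.1, BardenetHardy2020) for the benchmark: the bosonized Fermi sea
|det|, for which
m2 = E_DPP[L^3/(K_Z^{-1})_{11}] = mean inverse squared L^2-norm of the cardinal interpolation
functions, is Tonks-Girardeau in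
d = 1 (no BEC, Lenard1964, ForresterEtAl2003) and an open, computable question in d = 3. Unlike the
four existing routes
(IR bound, periodic reduction, pinning, RG) nothing here pays the kinetic gap L^{-2} or needs
LHY-precision energies, and
unlike BECPeriodicReduction no boundary-condition transfer is needed: the inequality is blind to
walls. Negatives index:
empty at filing.

RANKED CRUXES. #2 ChiSquareTolerance (crux) — X itself (card item C1, corrected to the liminf form):
for every repulsive finite-range v there is rho0 > 0 such that for 0 < rho < rho0 there is C > 0
with: for all large N = n+1 and every delta > 0 SOME delta-near-minimiser Psi of the Dirichlet
energy (box side (N/rho)^{1/3}) has m2(Psi) = L^3 Int_Y Int_x |Psi(x::Y)|^4 / Int_x' |Psi(x'::Y)|^2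
<= C. Equivalent (given compactness and a unique positive ground state Psi0) to m2(Psi0) <= C by
lower semicontinuity of m2; the sup-over-near-minimisers form is false (SpikeObstruction).
[difficulty: open-problem] (why it might fail: chi^2 is an L^2 (not KL) functional of the
conditional density p(x|Y): rare bath configurations Y that cage the last boson (three-body contact,
probability ~ (rho a^3)^2 but L^3 p ~ L^3/a^3) or an infrared pile-up of the phonon tail of log p
could make E_mu[L^3 p] grow with N although BEC holds.) [Reatto1969, ReattoChester1967,
LiebSeiringerSolovejYngvason2005, HolroydSoo2013, PenroseOnsager1956, GhoshLebowitz2017]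
#3 FermiSeaBenchmark (crux) — the card's benchmark (F) in d = 3, off the assembly path: for the
bosonized Fermi sea Psi_R = det[e^{2 pi i k_a . x_b}]_{a,b} / sqrt(N!) on the unit torus [0,1)^3,
modes k in Z^3 with |k|^2 <= R^2 (closed shells, N = N(R) = 1, 7, 33, 123, 257, 515, 925, ...), the
mean self-conditional density is bounded uniformly in R: (1/N!) Int_{cell^N} |det X|^4 / Int_{cell}
|det(X with x_i replaced)|^2 <= C for every particle index i. Equivalently sup_N E_{Z ~ DPP(Fermi
ball)}[L^3/(K_Z^{-1})_{11}] < inf, equivalently the cardinal (Lagrange) functions l_i of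
trigonometric interpolation on a Fermi-ball DPP sample satisfy E[(1/N) sum_i ||l_i||_2^{-2}] = O(1);
by DeletionBound it gives n0(|Psi_F|) >= N/C: the bosonized 3-D Fermi sea Bose-condenses.
[difficulty: L] (why it might fail: if the hole function (band-limited to the Fermi ball, vanishing
on the other N-1 points) localises at the vacancy like a Wannier/sinc function, ||l_i||^2 ~ 1/N and
m2 ~ N^gamma also in d = 3 (as in d = 1, where m2 >= N/n0 ~ 0.65 sqrt N): then |Psi_F| does NOT
condense.) [TorquatoScardicchioZachary2008, HughesKeatingOconnell2001, ShiraiTakahashi2003,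
GhoshPeres2017, Bufetov2018, Lyons2003, GroverFisher2015, BardenetHardy2020, Lenard1964,
ForresterEtAl2003]
#4 DeletionReachesGroundState (crux) — transfer to near-minimisers (card item C3): for every
repulsive finite-range v there is rho0 > 0 such that for 0 < rho < rho0, all large N = n+1 and every
C > 0: IF for every delta > 0 some delta-near-minimiser has m2 <= C, THEN there is delta > 0 such
that EVERY delta-near-minimiser Psi has constant-mode occupation <phi0, gamma_Psi phi0> >= N/(2C),
phi0 = L^{-3/2} 1_box. Content: E0 < top at low density; uniqueness and positivity of the Dirichlet
ground state Psi0 (Perron-Frobenius for the Friedrichs realisation, incl. hard cores);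
L^2-convergence of near-minimisers to Psi0 modulo phase (compact resolvent); lower semicontinuity of
m2 (perspective convexity + Fatou) giving m2(Psi0) <= C; DeletionBound for Psi0; L^2-continuity of
n0. [deps: DeletionBound] [difficulty: L] (why it might fail: needs a UNIQUE positive Dirichlet
ground state for every admissible v: v = top on a shell splits configuration space into chambers
(possible degeneracy); hard cores need connectivity of the hard-sphere configuration space at low
density; else restate for v finite a.e. / true hard cores.) [ReedSimonIV1978,
LiebSeiringerSolovejYngvason2005, PenroseOnsager1956]
#9 DeletionBound (support) — the exact one-line theorem (sharpened card mechanism): for every n, L >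
0 and every measurable Psi : Config(n+1) -> C that is pointwise real and >= 0, vanishes off the box
Lambda_L^{n+1} and has Int |Psi|^2 = 1: (n+1) <= n0(Psi) * m2(Psi), where n0 = occupation of phi0 =
L^{-3/2} 1_box and m2 = L^3 Int_Y Int_x |Psi(x::Y)|^4 / Int_x' |Psi(x'::Y)|^2 (ENNReal,
division-free). Proof: Hoelder b <= S^{2/3}A^{1/3} in x, then Cauchy-Schwarz in Y (see Why this
line). No symmetry or translation invariance needed. [difficulty: provable-now] [PenroseOnsager1956,
LiebSeiringerSolovejYngvason2005]
#9 SpikeObstruction (support) — negative side, certifies the liminf form of ChiSquareTolerance: the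
SUP form ('there is delta > 0 such that EVERY delta-near-minimiser has m2 <= C') is FALSE already
for v = 0: adding to a smooth near-minimiser a symmetrised C^1 spike of amplitude A and width w
(L^2-mass A^2 w^{3N} -> 0) raises m2 by K ~ L^3 A^2 w^{3N-3} at kinetic cost ~ K w / L^3 -> 0, so
near-minimisers of arbitrarily small slack have unbounded m2. [difficulty: M]
[LiebSeiringerSolovejYngvason2005]

TWO-LAYER PLAN. Foreseen glued splits (filed only when a crux closes or stalls): ChiSquareTolerance
⇐ TorusTolerance (the same bound,
m2 <= 1 + C sqrt(rho a^3), for the periodic ground state, where the one-body density is uniform and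
m2 = 1 + chi^2(Palm ||
marginal) literally) → WallLayerTransfer (Dirichlet conditional density <= C/L^3 off a
healing-length boundary layer) →
ChiSquareTolerance; alternatively ChiSquareTolerance ⇐ PapangelouSecondMoment (second moment of the
GNZ conditional
intensity lambda*(x|Y)/rho of |Psi0|^2 bounded via local energy / Feynman-Kac ratio bounds) →
ChiSquareTolerance.
DeletionReachesGroundState ⇐ GroundStateConvergence (E0 < top, unique positive Psi0, near-minimisers
→ Psi0 in L^2 mod
phase) → SemicontinuityTransfer (lsc of m2, continuity of n0, DeletionBound) →
DeletionReachesGroundState. FermiSeaBenchmark ⇐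
CardinalDelocalisation (E ||l_i||_2^{-2} = O(1) via negative moments of |det| ratios under the
Fermi-ball DPP) → FermiSeaBenchmark.
A periodic twin TorusTolerance → PeriodicBEC (stmt-AtomisticToContinuum-0826, via
condensateOccupation >= N/m2 on the cell)
would be filed as support once TorusTolerance exists as a child.

KILL CRITERIA. A proof that m2(Psi0) -> inf along N for the Dirichlet (or periodic) ground state of
some admissible v at arbitrarily small
rho refutes ChiSquareTolerance and closes the route (close --reason refuted:ChiSquareTolerance); it
does NOT refute the
conjunct (chi^2 is stronger than needed) — the positivity programme then falls back to the KL /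
Renyi-1/2 criteria of cards
renyi-entropic-delocalisation and swap-affinity-insertion-variance. ¬DeletionReachesGroundState
exhibited through a
degenerate Dirichlet ground state for an exotic v (chambers of v = top on a shell) forces a pivot:
restate rank 4 (and the
conjunct reading) for v finite a.e. plus genuine hard cores, not a close. ¬FermiSeaBenchmark (m2 ~
N^gamma for the 3-D
Fermi ball) does not touch the assembly: it is recorded as the negative benchmark 'the bosonized 3-D
Fermi sea is a
non-condensed Bose state' and sharpens rank 2's why-might-fail (hyperuniformity with S(k) ~ k would
then not suffice for
tolerance). PeriodicBEC + BoundaryTransferWeak or PinnedLowerBound proved elsewhere moots the route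
(conjunct closed).

NOT DECOMPOSED YET. How to bound m2 for the true ground state (GNZ/Campbell identity E[sum_i h(x_i,
X minus x_i)] = Int E_{P_x}[h] rho dx, the
Papangelou intensity, three-body cage estimates, Feynman-Kac ratio bounds for Psi0(x,Y)/Psi0(x',Y))
— layer-2 children of
rank 2; the periodic twin and its link to PeriodicBEC (0826); the lambda_max (tr rho_1^2 >= m2^{-2})
version of the
inequality; the d = 2 benchmark and the d = 1 negative calibration (lives in
Literature.Barriers.AtomisticToContinuum.OneDimensionalHardCore:
zeroMomentumOccupation ~ sqrt N forces m2(TG) >= N/n0 ~ 0.65 sqrt N); the spectral/compactness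
package behind rank 4;
positive temperature.

CHEAPEST FALSIFIER. For rank 3 (and the credibility of rank 2): exact HKPV sampling of the
Fermi-ball projection DPP on the unit torus,
N = 7..515 (d = 3), with d = 1 (N = 3..513) as control: per sample Z invert Phi = [e^{2 pi i
k.z_j}], D_i = 1/||Phi^{-1} e_i||^2,
m2(N) = E[(1/N) sum_i D_i], and n0/N = E_i[(Int |l_i| dx)^2 / ||l_i||^2] by Monte Carlo over uniform
x. Saturation of m2 in
d = 3 with growth ~ N^c in d = 1 supports (F); growth in d = 3 kills (F) (not the route). Script
written this session
(fermi_benchmark/main.py, numpy, ~1 CPU-hour; attached as evidence to the rank-3 item); NOT run: the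
hub's compute socket was
absent for the whole session (kit compute submit rc 2). For rank 2 directly: classical Monte Carlo
of the hard-sphere /
scattering-solution Jastrow fluid |Psi_J|^2 at rho a^3 = 1e-3..1e-1, N = 100..1000, estimating m2 =
<e^{-2 Delta W}>/<e^{-Delta W}>^2
by Widom insertion: growth with N would kill the line at the trial-state level already.
Known-theorem check done: v = 0 passes
all items (Dirichlet free gas m2 = 27/8, n0/N = (8/pi^2)^3 = 0.533 >= 8/27; torus m2 = 1, n0 = N,
equality).

NUMBERS. Free gas, Dirichlet box: m2 = (3/2)^3 = 3.375, n0/N = (8/pi^2)^3 = 0.5331, bound 1/m2 =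
0.2963. Free gas, torus: m2 = 1, n0 = N
(DeletionBound is an equality). Tonks-Girardeau (d = 1, = |Fermi sea|): n0 ≈ 1.54 sqrt N
(Lenard1964, ForresterEtAl2003) so
m2 >= 0.65 sqrt N. Jastrow heuristic for the dilute 3-D gas: Var_x W ≈ 16 pi rho a^2 xi = 16 pi (8
pi)^{-1/2} sqrt(rho a^3) ≈
10 sqrt(rho a^3), so m2 - 1 = O(sqrt(rho a^3)) against the Bogoliubov depletion (8/(3 sqrt pi))
sqrt(rho a^3) ≈ 1.50 sqrt(rho a^3):
right order, constant not sharp. Closed-shell N for |k|^2 <= R^2 in d = 3: 1, 7, 33, 123, 257, 515,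
925. Items at open: 6
(3 cruxes, 2 support, 1 assembly).

DEFINITION REQUESTS. One convenience definition (filed after open, --for the rank-2 item):
`meanSelfDensity (n : ℕ) (L : ℝ) (Ψ : Config (n+1) → ℂ) : ENNReal :=
ENNReal.ofReal (L^3) * ∫⁻ Y, ∫⁻ x, ‖Ψ (x::Y)‖₊^4 / ∫⁻ x', ‖Ψ (x'::Y)‖₊^2` under
Summits/AtomisticToContinuum/BoseEinsteinCondensation/Theorems,
so that later children and the periodic twin are short; the items filed now inline it (definitional
unfolding). Cite fact
wanted (not blocking): Reatto1969 (BEC for Jastrow wave functions via the classical-fluid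
representation of n0; acq-01364,
cite-only).

Novelty: Searches (2026-08-15, this session; OpenAlex / Semantic Scholar / arXiv APIs answered HTTP 429
throughout, galaxy --star all
queued > 90 s): `lit search --source crossref "lower bound condensate fraction Jastrow wave function
Jensen inequality Bose"`
(12: Reatto-school Jastrow papers doi:10.1103/physreva.18.296, doi:10.1103/physrevb.22.1237, Leggett
NJP 2001 UPPER bound
doi:10.1088/1367-2630/3/1/323 — no Hoelder/conditional-density lower bound); `lit search --source
crossref "Bufetov
quasi-symmetries determinantal"` (6: doi:10.1214/17-aop1198, doi:10.1134/s0016266320010025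
conditional measures of DPPs,
doi:10.1214/19-aap1504); `lit search --source zbmath "determinantal point process deletion tolerance
Palm measure absolutely
continuous higher dimensions"` (0); `lit search --hybrid --source local "condensate fraction lower
bound positive ground state
conditional density"` (12 textbooks: LSSY2005 pp 13/57/134, Griffin-Snoke-Stringari 1995 — grep for
bounds on n0: none
relevant); `lit vsearch` of the inequality in prose (10 textbooks, none); `lit frontier
AtomisticToContinuum --since 2020` (30;
BEC descendants arXiv:2603.20776, arXiv:2510.20493, arXiv:2602.16566 — all gap/energy based); `lit
read` HolroydSoo2013 pp 2-3
(Thm 1.1/1.2 definitions), TorquatoScardicchioZachary2008 §4.1 p 9-10 (Fermi-sphere DPP, S(k) = c(d)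
k/2K); plus the card's
audit-12 record (crossref 'off-diagonal long-range order absolute value free fermion ground state',
zbMATH DPP-rigidity
census, READ arXiv:1  [refs: 10.1103/physreva.18.296, 10.1103/physrevb.22.1237, 10.1088/1367-2630/3/1/323, 10.1214/17-aop1198, 10.1134/s0016266320010025, 10.1214/19-aap1504, 10.1103/physrev.183.334:, 2603.20776, 2510.20493, 2602.16566, 1412.3534, doi:10.1103/physreva.18.296, doi:10.1103/physrevb.22.1237, doi:10.1088/1367-2630/3/1/323, doi:10.1214/17-aop1198, doi:10.1134/s0016266320010025, doi:10.1214/19-aap1504, doi:10.1103/p]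

Barriers (technique_class: ground-state-positivity point-process palm-chi-square): - technique_class: ground-state-positivity point-process palm-chi-square
- Literature.Barriers.AtomisticToContinuum.KineticGapLengthScales: evaded — no spectral gap, no
Poincare inequality, no localisation to sub-boxes; m2 is bounded directly as a property of the
conditional law of one particle, never through (box side)^2 x (excess energy).
- Literature.Barriers.AtomisticToContinuum.EnergyAsymptoticsWithoutCondensation: evaded — no energy
asymptotics are used; the 1-D Lieb-Liniger witness is exactly where m2 diverges (Tonks-Girardeau m2
>= 0.65 sqrt N), consistent.
- Literature.Barriers.AtomisticToContinuum.BogoliubovPerturbationInfrared: not met by the inequality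
or the benchmark; it would bite a PERTURBATIVE evaluation of E_mu[L^3 p] for |Psi0|^2 (the
shot-noise second moment of the insertion landscape must be controlled non-perturbatively at the
healing scale) — conceded in rank 2's why-might-fail.
- Literature.Barriers.AtomisticToContinuum.OneDimensionalHardCore: respected and used as calibration
(d = 1: |Fermi sea| = Girardeau's state, zeroMomentumOccupation ~ sqrt N, so the bound degenerates
exactly as it must).
- Literature.Barriers.AtomisticToContinuum.HohenbergLowDimension: respected — T = 0 only; dimension
enters through the infrared integrability of 1/S(k) (alpha = 1 < d), which is what separates d = 1
from d = 3 in the tolerance dictionary.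
- Literature.Barriers.AtomisticToContinuum.PitaevskiiStringariOneDimension: respected — same remark,
the 1-D T = 0 exclusion

History (route lifecycle, newest last):
- 2026-08-15T13:38:42Z · CLOSED retired — not-a-thesis: assembly does not conclude the sub-problem Statement (operator:999:1257524)

sub-problem: BoseEinsteinCondensation · status: closed(retired) · opened planner-plancard-AtomisticToContinuum-BoseEin-95b2a624-0 2026-08-15T11:33:10Z · rev 0 · ledger route-AtomisticToContinuum-BECDeletionTolerance
GENERATED by the gate from the ledger (D-0016/17). Provers cite these decls: `theorem foo : Summit.AtomisticToContinuum.BoseEinsteinCondensation.Theses.BECDeletionTolerance.<Decl> := …` in Summits/AtomisticToContinuum/BoseEinsteinCondensation/Theorems/<Name>.lean.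
-/

namespace Summit.AtomisticToContinuum.BoseEinsteinCondensation.Theses.BECDeletionTolerance

open scoped BigOperators Topology Manifold Classical MeasureTheory ProbabilityTheory Matrix InnerProductSpace ComplexConjugate ContinuousMap
open Filter Set Function TopologicalSpace MeasureTheory

attribute [summit_statement] _root_.BoseEinsteinCondensation

/-- item stmt-AtomisticToContinuum-4367 · crux · rank 2 · closed · moot by None · by planner
why it might fail: chi^2 is an L^2 (not KL) functional of the conditional density p(x|Y): rare bath configurations Y that cage the last boson (three-body contact, probability ~ (rho a^3)^2 but L^3 p ~ L^3/a^3) or an infrared pile-up of the phonon tail of log p could make E_mu[L^3 p] grow with N although BEC holds.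
sources: Reatto1969, ReattoChester1967, LiebSeiringerSolovejYngvason2005, HolroydSoo2013, PenroseOnsager1956, GhoshLebowitz2017
[crux] X itself (card item C1, corrected to the liminf form): for every repulsive finite-range v
there is rho0 > 0 such that for 0 < rho < rho0 there is C > 0 with: for all large N = n+1 and every
delta > 0 SOME delta-near-minimiser Psi of the Dirichlet energy (box side (N/rho)^{1/3}) has m2(Psi)
= L^3 Int_Y Int_x |Psi(x::Y)|^4 / Int_x' |Psi(x'::Y)|^2 <= C. Equivalent (given compactness and a
unique positive ground state Psi0) to m2(Psi0) <= C by lower semicontinuity of m2; the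
sup-over-near-minimisers form is false (SpikeObstruction). [difficulty: open-problem] -/
@[route_item "route-AtomisticToContinuum-BECDeletionTolerance"]
def ChiSquareTolerance : Prop :=
  ∀ v : ℝ → ENNReal, Literature.MathematicalPhysics.QuantumManyBody.BoseGas.IsRepulsiveFiniteRange v → ∃ ρ₀ : ℝ, 0 < ρ₀ ∧ ∀ ρ : ℝ, 0 < ρ → ρ < ρ₀ → ∃ C : ℝ, 0 < C ∧ ∀ᶠ n : ℕ in Filter.atTop, ∀ δ : ENNReal, 0 < δ → ∃ Ψ : Literature.MathematicalPhysics.QuantumManyBody.BoseGas.TrialState (n + 1) (Literature.MathematicalPhysics.QuantumManyBody.BoseGas.sideLength ρ (n + 1)), Literature.MathematicalPhysics.QuantumManyBody.BoseGas.energy v Ψ ≤ Literature.MathematicalPhysics.QuantumManyBody.BoseGas.groundStateEnergy v (n + 1) (Literature.MathematicalPhysics.QuantumManyBody.BoseGas.sideLength ρ (n + 1)) + δ ∧ ENNReal.ofReal (Literature.MathematicalPhysics.QuantumManyBody.BoseGas.sideLength ρ (n + 1) ^ 3) * (∫⁻ Y : Literature.MathematicalPhysics.QuantumManyBody.BoseGas.Config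 n, ∫⁻ x : Literature.MathematicalPhysics.QuantumManyBody.BoseGas.Space, (‖Ψ.ψ (Matrix.vecCons x Y)‖₊ : ENNReal) ^ 4 / (∫⁻ x' : Literature.MathematicalPhysics.QuantumManyBody.BoseGas.Space, (‖Ψ.ψ (Matrix.vecCons x' Y)‖₊ : ENNReal) ^ 2)) ≤ ENNReal.ofReal C

/-- item stmt-AtomisticToContinuum-4368 · crux · rank 3 · closed · moot by None · by planner
why it might fail: if the hole function (band-limited to the Fermi ball, vanishing on the other N-1 points) localises at the vacancy like a Wannier/sinc function, ||l_i||^2 ~ 1/N and m2 ~ N^gamma also in d = 3 (as in d = 1, where m2 >= N/n0 ~ 0.65 sqrt N): then |Psi_F| does NOT condense.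
sources: TorquatoScardicchioZachary2008, HughesKeatingOconnell2001, ShiraiTakahashi2003, GhoshPeres2017, Bufetov2018, Lyons2003
[crux] the card's benchmark (F) in d = 3, off the assembly path: for the bosonized Fermi sea Psi_R =
det[e^{2 pi i k_a . x_b}]_{a,b} / sqrt(N!) on the unit torus [0,1)^3, modes k in Z^3 with |k|^2 <=
R^2 (closed shells, N = N(R) = 1, 7, 33, 123, 257, 515, 925, ...), the mean self-conditional density
is bounded uniformly in R: (1/N!) Int_{cell^N} |det X|^4 / Int_{cell} |det(X with x_i replaced)|^2
<= C for every particle index i. Equivalently sup_N E_{Z ~ DPP(Fermi ball)}[L^3/(K_Z^{-1})_{11}] <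
inf, equivalently the cardinal (Lagrange) functions l_i of trigonometric interpolation on a
Fermi-ball DPP sample satisfy E[(1/N) sum_i ||l_i||_2^{-2}] = O(1); by DeletionBound it gives
n0(|Psi_F|) >= N/C: the bosonized 3-D Fermi sea Bose-condenses. [difficulty: L] -/
@[route_item "route-AtomisticToContinuum-BECDeletionTolerance"]
def FermiSeaBenchmark : Prop :=
  ∃ C : ℝ, ∀ R : ℕ, let S : Finset (Fin 3 → ℤ) := (Fintype.piFinset fun _ : Fin 3 => Finset.Icc (-(R : ℤ)) R).filter (fun k => ∑ j, k j ^ 2 ≤ (R : ℤ) ^ 2); ∀ i : Fin S.card, ((Nat.factorial S.card : ENNReal))⁻¹ * (∫⁻ X in Literature.MathematicalPhysics.QuantumManyBody.BoseGas.cellN S.card 1, (‖(Matrix.of fun a b : Fin S.card => Complex.exp (2 * Real.pi * Complex.I * ∑ j : Fin 3, (((S.equivFin.symm a : Fin 3 → ℤ) j : ℝ) : ℂ) * ((X b j : ℝ) : ℂ))).det‖₊ : ENNReal) ^ 4 / (∫⁻ x in Literature.MathematicalPhysics.QuantumManyBody.BoseGas.cell 1, (‖(Matrix.of fun a b : Fin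 S.card => Complex.exp (2 * Real.pi * Complex.I * ∑ j : Fin 3, (((S.equivFin.symm a : Fin 3 → ℤ) j : ℝ) : ℂ) * ((Function.update X i x b j : ℝ) : ℂ))).det‖₊ : ENNReal) ^ 2)) ≤ ENNReal.ofReal C

/-- item stmt-AtomisticToContinuum-4369 · crux · rank 4 · closed · moot by None · by planner
why it might fail: needs a UNIQUE positive Dirichlet ground state for every admissible v: v = top on a shell splits configuration space into chambers (possible degeneracy); hard cores need connectivity of the hard-sphere configuration space at low density; else restate for v finite a.e. / true hard cores.
sources: ReedSimonIV1978, LiebSeiringerSolovejYngvason2005, PenroseOnsager1956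
[crux] transfer to near-minimisers (card item C3): for every repulsive finite-range v there is rho0
> 0 such that for 0 < rho < rho0, all large N = n+1 and every C > 0: IF for every delta > 0 some
delta-near-minimiser has m2 <= C, THEN there is delta > 0 such that EVERY delta-near-minimiser Psi
has constant-mode occupation <phi0, gamma_Psi phi0> >= N/(2C), phi0 = L^{-3/2} 1_box. Content: E0 <
top at low density; uniqueness and positivity of the Dirichlet ground state Psi0 (Perron-Frobenius
for the Friedrichs realisation, incl. hard cores); L^2-convergence of near-minimisers to Psi0 modulo
phase (compact resolvent); lower semicontinuity of m2 (perspective convexity + Fatou) giving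
m2(Psi0) <= C; DeletionBound for Psi0; L^2-continuity of n0. [deps: DeletionBound] [difficulty: L] -/
@[route_item "route-AtomisticToContinuum-BECDeletionTolerance"]
def DeletionReachesGroundState : Prop :=
  ∀ v : ℝ → ENNReal, Literature.MathematicalPhysics.QuantumManyBody.BoseGas.IsRepulsiveFiniteRange v → ∃ ρ₀ : ℝ, 0 < ρ₀ ∧ ∀ ρ : ℝ, 0 < ρ → ρ < ρ₀ → ∀ᶠ n : ℕ in Filter.atTop, ∀ C : ℝ, 0 < C → (∀ δ : ENNReal, 0 < δ → ∃ Ψ : Literature.MathematicalPhysics.QuantumManyBody.BoseGas.TrialState (n + 1) (Literature.MathematicalPhysics.QuantumManyBody.BoseGas.sideLength ρ (n + 1)), Literature.MathematicalPhysics.QuantumManyBody.BoseGas.energy v Ψ ≤ Literature.MathematicalPhysics.QuantumManyBody.BoseGas.groundStateEnergy v (n + 1) (Literature.MathematicalPhysics.QuantumManyBody.BoseGas.sideLength ρ (n + 1)) + δ ∧ ENNReal.ofReal (Literature.MathematicalPhysics.QuantumManyBody.BoseGas.sideLength ρ (n + 1) ^ 3) * (∫⁻ Y : Literature.MathematicalPhysics.QuantumManyBody.BoseGas.Config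 n, ∫⁻ x : Literature.MathematicalPhysics.QuantumManyBody.BoseGas.Space, (‖Ψ.ψ (Matrix.vecCons x Y)‖₊ : ENNReal) ^ 4 / (∫⁻ x' : Literature.MathematicalPhysics.QuantumManyBody.BoseGas.Space, (‖Ψ.ψ (Matrix.vecCons x' Y)‖₊ : ENNReal) ^ 2)) ≤ ENNReal.ofReal C) → ∃ δ : ENNReal, 0 < δ ∧ ∀ Ψ : Literature.MathematicalPhysics.QuantumManyBody.BoseGas.TrialState (n + 1) (Literature.MathematicalPhysics.QuantumManyBody.BoseGas.sideLength ρ (n + 1)), Literature.MathematicalPhysics.QuantumManyBody.BoseGas.energy v Ψ ≤ Literature.MathematicalPhysics.QuantumManyBody.BoseGas.groundStateEnergy v (n + 1) (Literature.MathematicalPhysics.QuantumManyBody.BoseGas.sideLength ρ (n + 1)) + δ → ENNReal.ofReal ((n + 1) / (2 * C)) ≤ Literature.MathematicalPhysics.QuantumManyBody.BoseGas.occupation (n + 1) ((Literature.MathematicalPhysics.QuantumManyBody.BoseGas.box (Literature.MathematicalPhysics.QuantumManyBody.BoseGas.sideLength ρ (n + 1))).indicator fun _ => ((Real.sqrt (Literature.MathematicalPhysics.QuantumManyBody.BoseGas.sideLength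 ρ (n + 1) ^ 3))⁻¹ : ℂ)) Ψ.ψ

/-- item stmt-AtomisticToContinuum-4370 · support · rank 9 · closed · moot by None · by planner
sources: PenroseOnsager1956, LiebSeiringerSolovejYngvason2005
[support] the exact one-line theorem (sharpened card mechanism): for every n, L > 0 and every
measurable Psi : Config(n+1) -> C that is pointwise real and >= 0, vanishes off the box
Lambda_L^{n+1} and has Int |Psi|^2 = 1: (n+1) <= n0(Psi) * m2(Psi), where n0 = occupation of phi0 =
L^{-3/2} 1_box and m2 = L^3 Int_Y Int_x |Psi(x::Y)|^4 / Int_x' |Psi(x'::Y)|^2 (ENNReal,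
division-free). Proof: Hoelder b <= S^{2/3}A^{1/3} in x, then Cauchy-Schwarz in Y (see Why this
line). No symmetry or translation invariance needed. [difficulty: provable-now] -/
@[route_item "route-AtomisticToContinuum-BECDeletionTolerance"]
def DeletionBound : Prop :=
  ∀ (n : ℕ) (L : ℝ), 0 < L → ∀ Ψ : Literature.MathematicalPhysics.QuantumManyBody.BoseGas.Config (n + 1) → ℂ, Measurable Ψ → (∀ X, X ∉ Literature.MathematicalPhysics.QuantumManyBody.BoseGas.boxN (n + 1) L → Ψ X = 0) → (∀ X, (Ψ X).im = 0 ∧ 0 ≤ (Ψ X).re) → ∫⁻ X, (‖Ψ X‖₊ : ENNReal) ^ 2 = 1 → ((n + 1 : ℕ) : ENNReal) ≤ Literature.MathematicalPhysics.QuantumManyBody.BoseGas.occupation (n + 1) ((Literature.MathematicalPhysics.QuantumManyBody.BoseGas.box L).indicator fun _ => ((Real.sqrt (L ^ 3))⁻¹ : ℂ)) Ψ * (ENNReal.ofReal (L ^ 3) * (∫⁻ Y : Literature.MathematicalPhysics.QuantumManyBody.BoseGas.Config n, ∫⁻ x : Literature.MathematicalPhysics.QuantumManyBody.BoseGas.Space,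 (‖Ψ (Matrix.vecCons x Y)‖₊ : ENNReal) ^ 4 / (∫⁻ x' : Literature.MathematicalPhysics.QuantumManyBody.BoseGas.Space, (‖Ψ (Matrix.vecCons x' Y)‖₊ : ENNReal) ^ 2)))

/-- item stmt-AtomisticToContinuum-4371 · support · rank 9 · closed · moot by None · by planner
sources: LiebSeiringerSolovejYngvason2005
[support] negative side, certifies the liminf form of ChiSquareTolerance: the SUP form ('there is
delta > 0 such that EVERY delta-near-minimiser has m2 <= C') is FALSE already for v = 0: adding to a
smooth near-minimiser a symmetrised C^1 spike of amplitude A and width w (L^2-mass A^2 w^{3N} -> 0)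
raises m2 by K ~ L^3 A^2 w^{3N-3} at kinetic cost ~ K w / L^3 -> 0, so near-minimisers of
arbitrarily small slack have unbounded m2. [difficulty: M] -/
@[route_item "route-AtomisticToContinuum-BECDeletionTolerance"]
def SpikeObstruction : Prop :=
  ¬ (∀ v : ℝ → ENNReal, Literature.MathematicalPhysics.QuantumManyBody.BoseGas.IsRepulsiveFiniteRange v → ∃ ρ₀ : ℝ, 0 < ρ₀ ∧ ∀ ρ : ℝ, 0 < ρ → ρ < ρ₀ → ∃ C : ℝ, 0 < C ∧ ∀ᶠ n : ℕ in Filter.atTop, ∃ δ : ENNReal, 0 < δ ∧ ∀ Ψ : Literature.MathematicalPhysics.QuantumManyBody.BoseGas.TrialState (n + 1) (Literature.MathematicalPhysics.QuantumManyBody.BoseGas.sideLength ρ (n + 1)), Literature.MathematicalPhysics.QuantumManyBody.BoseGas.energy v Ψ ≤ Literature.MathematicalPhysics.QuantumManyBody.BoseGas.groundStateEnergy v (n + 1) (Literature.MathematicalPhysics.QuantumManyBody.BoseGas.sideLength ρ (n + 1)) + δ → ENNReal.ofReal (Literature.MathematicalPhysics.QuantumManyBody.BoseGas.sideLength ρ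 (n + 1) ^ 3) * (∫⁻ Y : Literature.MathematicalPhysics.QuantumManyBody.BoseGas.Config n, ∫⁻ x : Literature.MathematicalPhysics.QuantumManyBody.BoseGas.Space, (‖Ψ.ψ (Matrix.vecCons x Y)‖₊ : ENNReal) ^ 4 / (∫⁻ x' : Literature.MathematicalPhysics.QuantumManyBody.BoseGas.Space, (‖Ψ.ψ (Matrix.vecCons x' Y)‖₊ : ENNReal) ^ 2)) ≤ ENNReal.ofReal C)

/-- item stmt-AtomisticToContinuum-4372 · assembly · rank 1 · closed · moot by None · by planner
sources: LiebSeiringerSolovejYngvason2005, PenroseOnsager1956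
[assembly] ChiSquareTolerance → DeletionReachesGroundState → BoseEinsteinCondensation (the
conjunct). -/
@[route_item "route-AtomisticToContinuum-BECDeletionTolerance"]
def Assembly : Prop :=
  ChiSquareTolerance → DeletionReachesGroundState → Literature.MathematicalPhysics.QuantumManyBody.BoseGas.BoseEinsteinCondensation

end Summit.AtomisticToContinuum.BoseEinsteinCondensation.Theses.BECDeletionTolerance
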